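import Mathlib.Data.Nat.Factorization.Induction
import Mathlib.Data.Nat.Factorization.Basic
import Summits.KontsevichZagierPeriods.KontsevichZagierPeriods.Theorems.HurwitzMicroSectorsNormalFormPrincipleDlogMoves
import Summits.KontsevichZagierPeriods.KontsevichZagierPeriods.Theorems.HurwitzMicroSectorsNormalFormPrincipleSplitMoves

/-!
# `NormalFormPrinciple` (stmt-KontsevichZagierPeriods-3869), line `SketchIdeator1` — the registered
# sub-goal `nf_pole_one`: a simple rational pole is in normal form (siege attempt k3)

Pure proof file (`--supports` the crux stmt-KontsevichZagierPeriods-3869). It proves the registered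
sub-goal `nf_pole_one` of the split-denominator layer of the leaf `stub_boxRigidity` BY NAME AND
SIGNATURE, by reduction to the moves ALREADY LANDED for this crux and nothing else:

* `Theorems/HurwitzMicroSectorsNormalFormPrincipleDlogMoves.lean` (p107004): the empty slab,
  merging (rule 1b), splitting (rule 1a) and scaling (rule 2) moves for the dlog
  representations `[(a,b), c/y]`;
* `Theorems/HurwitzMicroSectorsNormalFormPrincipleSplitMoves.lean` (p107818): the affine move of
  either orientation, the images of slabs, and `[pt, 0] ∈ relations`.

Statement. `R a b c = [(a,b), c/y]` (`0 < a`) and `Z r = [pt, r]` are given families; `T = [(0,1),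
c/(x − ρ)]` with `ρ ∈ ℚ ∖ [0,1]`. Then, in `FormalRep ⧸ relations`,
`[T] = [Z r] + Σ_{p ∈ S} [R 1 p (C p)]` for some `r ∈ ℚ`, a finite set `S` of primes and
`C : ℕ → ℚ` vanishing off `S`.

Proof (assembly of landed moves).
1. Affine move `y = x − ρ` (`ρ < 0`) or `y = ρ − x` (`ρ > 1`): `[T] = [R a (a+1) c']` with
   `(a, c') = (−ρ, c)` resp. `(ρ − 1, −c)`, `0 < a`.
2. Scaling by `D = den a` and splitting at the integer ends `A = num a`, `B = A + D`:
   `[R a (a+1) c'] = [R A B c'] = Λ(B, c') − Λ(A, c')`, `Λ(N, c) := [R 1 N c]`.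
3. The carriers `Λ` are multiplicative in `N` (split + scale, `Λ(1,c) = 0` as an empty slab) and
   additive in `c` (merge: `exists_coeffHom`), hence `Λ(N, c) = Σ_p Λ(p, v_p(N)·c)` by induction on the prime
   factorisation; so `r = 0` (`[Z 0] ∈ relations`), `S = primeFactors A ∪ primeFactors B`,
   `C p = (v_p(B) − v_p(A))·c'`.

Sources: M. Kontsevich, D. Zagier, *Periods* (2001), §1.1 (`log 2 = ∫₁² dx/x`), §1.2 rules (1), (2).
No definitions are introduced; the declarations live in their own sub-namespace `…PiBox.Dlog.SiegeK3`.
-/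

noncomputable section

open MeasureTheory Set Finset
open Literature.NumberTheory.Transcendental Literature.NumberTheory.Transcendental.KZ

namespace Summit.KontsevichZagierPeriods.HurwitzMicroSectors.NormalFormPrinciple.PiBox

namespace Dlog

namespace SiegeK3

/-! ## The dlog family `R a b c = [(a,b), c/y]` and its carriers `Λ(N, c) = [R 1 N c]` -/

section Carriers

variable {R : ℚ → ℚ → ℚ → IntegralRep 1}
  (hR : ∀ a b c, 0 < a → (R a b c).domain = {x | x 0 ∈ Set.Ioo (a:ℝ) b} ∧
    (R a b c).integrand = fun x => (c:ℝ) / x 0)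
include hR

/-- **The coefficient homomorphism** (merging, rule 1b): for `0 < a` the class of
`[(a,b), c/y]` modulo relations is additive in `c`, i.e. `c ↦ [R a b c]` is (the underlying map
of) an additive homomorphism `ℚ →+ FormalRep ⧸ relations`.
[cite: KontsevichZagier2001, §1.2 rule (1)] -/
theorem exists_coeffHom {a : ℚ} (ha : 0 < a) (b : ℚ) :
    ∃ φ : ℚ →+ FormalRep ⧸ relations,
      ∀ x, φ x = QuotientAddGroup.mk' relations (of (R a b x)) := by
  refine ⟨AddMonoidHom.mk' (fun x => QuotientAddGroup.mk' relations (of (R a b x)))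
    fun x y => ?_, fun x => rfl⟩
  have h := dlog_merge_mem_relations (σ := {w : Fin 1 → ℝ | w 0 ∈ Set.Ioo (a:ℝ) b})
    (c := x) (c' := y) (R a b (x + y)) (R a b x) (R a b y) (hR a b _ ha).1 (hR a b _ ha).1
    (hR a b _ ha).1 (fun w _ => by rw [(hR a b (x + y) ha).2])
    (fun w _ => by rw [(hR a b x ha).2]) (fun w _ => by rw [(hR a b y ha).2])
  have e : of (R a b (x + y)) - (of (R a b x) + of (R a b y)) =
      of (R a b (x + y)) - of (R a b x) - of (R a b y) := by abel
  show QuotientAddGroup.mk' relations (of (R a b (x + y))) =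
    QuotientAddGroup.mk' relations (of (R a b x)) + QuotientAddGroup.mk' relations (of (R a b y))
  rw [← map_add, QuotientAddGroup.mk'_apply, QuotientAddGroup.mk'_apply,
    QuotientAddGroup.eq_iff_sub_mem, e]
  exact h

/-- Natural multiples in the coefficient: `k • [R a b c] = [R a b (k c)]` modulo relations
(`0 < a`). [cite: KontsevichZagier2001, §1.2 rule (1)] -/
theorem nsmul_mk_dlog {a : ℚ} (ha : 0 < a) (b : ℚ) (k : ℕ) (c : ℚ) :
    k • QuotientAddGroup.mk' relations (of (R a b c)) =
      QuotientAddGroup.mk' relations (of (R a b (k * c))) := by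
  obtain ⟨φ, hφ⟩ := exists_coeffHom hR ha b
  rw [← hφ c, ← hφ (k * c), ← nsmul_eq_mul, map_nsmul]

/-- Subtraction in the coefficient: `[R a b c] − [R a b c'] = [R a b (c − c')]` modulo relations
(`0 < a`). [cite: KontsevichZagier2001, §1.2 rule (1)] -/
theorem mk_dlog_sub {a : ℚ} (ha : 0 < a) (b c c' : ℚ) :
    QuotientAddGroup.mk' relations (of (R a b c)) - QuotientAddGroup.mk' relations (of (R a b c')) =
      QuotientAddGroup.mk' relations (of (R a b (c - c'))) := by
  obtain ⟨φ, hφ⟩ := exists_coeffHom hR ha b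
  rw [← hφ c, ← hφ c', ← hφ (c - c'), map_sub]

/-- **The empty carrier**: `Λ(1, c) = [R 1 1 c] = 0` (empty slab).
[cite: KontsevichZagier2001, §1.2 rule (1)] -/
theorem mk_carrier_one (c : ℚ) :
    QuotientAddGroup.mk' relations (of (R 1 ((1:ℕ):ℚ) c)) = 0 := by
  rw [QuotientAddGroup.mk'_apply, QuotientAddGroup.eq_zero_iff]
  exact slab_empty_mem_relations (a := ((1:ℚ):ℝ)) (b := (((1:ℕ):ℚ):ℝ)) _
    (hR 1 _ c one_pos).1 (by push_cast; exact le_rfl)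

/-- **Multiplicativity of the carriers**: `Λ(MN, c) = Λ(M, c) + Λ(N, c)` for `1 ≤ M, N` —
split `[1, MN]` at `M` (rule 1a) and rescale `[M, MN]` to `[1, N]` (rule 2).
[cite: KontsevichZagier2001, §1.2 rules (1), (2)] -/
theorem mk_carrier_mul (c : ℚ) {M N : ℕ} (hM : 1 ≤ M) (hN : 1 ≤ N) :
    QuotientAddGroup.mk' relations (of (R 1 ((M * N : ℕ):ℚ) c)) =
      QuotientAddGroup.mk' relations (of (R 1 (M:ℚ) c)) +
        QuotientAddGroup.mk' relations (of (R 1 (N:ℚ) c)) := by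
  have hM0 : (0:ℚ) < M := by exact_mod_cast hM
  -- splitting `[1, MN] ≡ [1, M] + [M, MN]`
  have h1 : of (R 1 ((M * N : ℕ):ℚ) c) - of (R 1 (M:ℚ) c) - of (R M ((M * N : ℕ):ℚ) c) ∈
      relations := by
    refine split_mem_relations (a := ((1:ℚ):ℝ)) (b := ((M:ℚ):ℝ)) (b' := (((M * N : ℕ):ℚ):ℝ))
      _ _ _ (hR 1 _ c one_pos).1 (hR 1 _ c one_pos).1 (hR M _ c hM0).1 ?_ ?_ ?_ ?_
    · exact_mod_cast hM
    · have : M ≤ M * N := Nat.le_mul_of_pos_right M hN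
      exact_mod_cast this
    · intro x _
      rw [(hR 1 (M:ℚ) c one_pos).2, (hR 1 ((M * N : ℕ):ℚ) c one_pos).2]
    · intro x _
      rw [(hR (M:ℚ) ((M * N : ℕ):ℚ) c hM0).2, (hR 1 ((M * N : ℕ):ℚ) c one_pos).2]
  -- scaling `[1, N] ≡ [M, MN]`
  have h2 : of (R 1 (N:ℚ) c) - of (R M ((M * N : ℕ):ℚ) c) ∈ relations := by
    refine dlog_scale_mem_relations (a := 1) (b := N) (c := c) (s := M) _ _ (hR 1 _ c one_pos).1
      ?_ (fun x _ => by rw [(hR 1 (N:ℚ) c one_pos).2])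
      (fun x _ => by rw [(hR (M:ℚ) ((M * N : ℕ):ℚ) c hM0).2]) one_pos hM0
    rw [(hR (M:ℚ) ((M * N : ℕ):ℚ) c hM0).1]
    push_cast
    rw [mul_one]
  have e : of (R 1 ((M * N : ℕ):ℚ) c) - (of (R 1 (M:ℚ) c) + of (R 1 (N:ℚ) c)) =
      (of (R 1 ((M * N : ℕ):ℚ) c) - of (R 1 (M:ℚ) c) - of (R M ((M * N : ℕ):ℚ) c)) -
        (of (R 1 (N:ℚ) c) - of (R M ((M * N : ℕ):ℚ) c)) := by abel
  rw [← map_add, QuotientAddGroup.mk'_apply, QuotientAddGroup.mk'_apply,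
    QuotientAddGroup.eq_iff_sub_mem, e]
  exact relations.sub_mem h1 h2

/-- **Prime decomposition of a carrier**: for `N ≠ 0`,
`Λ(N, c) = Σ_p v_p(N) • Λ(p, c)` (sum over the factorisation of `N`), by induction on the
prime factorisation using multiplicativity. [cite: KontsevichZagier2001, §1.2 rules (1), (2)] -/
theorem mk_carrier_eq_factorization_sum (c : ℚ) (N : ℕ) (hN : N ≠ 0) :
    QuotientAddGroup.mk' relations (of (R 1 (N:ℚ) c)) =
      N.factorization.sum fun p k => k • QuotientAddGroup.mk' relations (of (R 1 (p:ℚ) c)) := by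
  revert hN
  refine induction_on_primes (motive := fun N : ℕ => N ≠ 0 →
      QuotientAddGroup.mk' relations (of (R 1 (N:ℚ) c)) =
        N.factorization.sum fun p k => k • QuotientAddGroup.mk' relations (of (R 1 (p:ℚ) c)))
    ?_ ?_ ?_ N
  · intro h
    exact absurd rfl h
  · intro _
    rw [Nat.factorization_one, Finsupp.sum_zero_index]
    exact mk_carrier_one hR c
  · intro p a hp ih hpa
    have ha0 : a ≠ 0 := by
      rintro rfl
      exact hpa (mul_zero p)
    rw [mk_carrier_mul hR c hp.one_lt.le (Nat.one_le_iff_ne_zero.mpr ha0),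
      Nat.factorization_mul hp.ne_zero ha0,
      Finsupp.sum_add_index'
        (h := fun (q : ℕ) (k : ℕ) => k • QuotientAddGroup.mk' relations (of (R 1 (q:ℚ) c)))
        (fun q => zero_nsmul _) (fun q k l => add_nsmul _ k l),
      hp.factorization, Finsupp.sum_single_index
        (h := fun (q : ℕ) (k : ℕ) => k • QuotientAddGroup.mk' relations (of (R 1 (q:ℚ) c)))
        (zero_nsmul _), one_nsmul, ih ha0]

/-- **Prime decomposition of a carrier, Finset form**: for `N ≠ 0` and any finite set `S`
containing the prime factors of `N`, `Λ(N, c) = Σ_{p ∈ S} Λ(p, v_p(N)·c)`.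
[cite: KontsevichZagier2001, §1.2 rules (1), (2)] -/
theorem mk_carrier_eq_finset_sum (c : ℚ) {N : ℕ} (hN : N ≠ 0) {S : Finset ℕ}
    (hS : N.primeFactors ⊆ S) :
    QuotientAddGroup.mk' relations (of (R 1 (N:ℚ) c)) =
      ∑ p ∈ S, QuotientAddGroup.mk' relations (of (R 1 (p:ℚ) ((N.factorization p : ℚ) * c))) := by
  rw [mk_carrier_eq_factorization_sum hR c N hN, Finsupp.sum, Nat.support_factorization,
    Finset.sum_subset hS]
  · refine Finset.sum_congr rfl fun p _ => ?_
    exact nsmul_mk_dlog hR one_pos _ _ _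
  · intro p _ hp
    have h0 : N.factorization p = 0 := by
      rw [← Finsupp.notMem_support_iff, Nat.support_factorization]
      exact hp
    simp only [h0, zero_nsmul]

/-- **Integer slab on the carriers**: for integers `1 ≤ A ≤ B`,
`[R A B c] = Λ(B, c) − Λ(A, c)` (split `[1, B]` at `A`).
[cite: KontsevichZagier2001, §1.2 rule (1)] -/
theorem mk_slab_nat_eq (c : ℚ) {A B : ℕ} (hA : 1 ≤ A) (hAB : A ≤ B) :
    QuotientAddGroup.mk' relations (of (R (A:ℚ) (B:ℚ) c)) =
      QuotientAddGroup.mk' relations (of (R 1 (B:ℚ) c)) -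
        QuotientAddGroup.mk' relations (of (R 1 (A:ℚ) c)) := by
  have hA0 : (0:ℚ) < A := by exact_mod_cast hA
  have h1 : of (R 1 (B:ℚ) c) - of (R 1 (A:ℚ) c) - of (R (A:ℚ) (B:ℚ) c) ∈ relations := by
    refine split_mem_relations (a := ((1:ℚ):ℝ)) (b := ((A:ℚ):ℝ)) (b' := ((B:ℚ):ℝ))
      _ _ _ (hR 1 _ c one_pos).1 (hR 1 _ c one_pos).1 (hR A _ c hA0).1 ?_ ?_ ?_ ?_
    · exact_mod_cast hA
    · exact_mod_cast hAB
    · intro x _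
      rw [(hR 1 (A:ℚ) c one_pos).2, (hR 1 (B:ℚ) c one_pos).2]
    · intro x _
      rw [(hR (A:ℚ) (B:ℚ) c hA0).2, (hR 1 (B:ℚ) c one_pos).2]
  have e : of (R (A:ℚ) (B:ℚ) c) - (of (R 1 (B:ℚ) c) - of (R 1 (A:ℚ) c)) =
      -(of (R 1 (B:ℚ) c) - of (R 1 (A:ℚ) c) - of (R (A:ℚ) (B:ℚ) c)) := by abel
  rw [← map_sub, QuotientAddGroup.mk'_apply, QuotientAddGroup.mk'_apply,
    QuotientAddGroup.eq_iff_sub_mem, e]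
  exact relations.neg_mem h1

/-- **Rational slab of length one on the carriers**: for rational `0 < a`, with `D = den a`,
`A = num a`, `B = A + D`: `[R a (a+1) c] = Λ(B, c) − Λ(A, c)` (scale by `D`, then split).
[cite: KontsevichZagier2001, §1.2 rules (1), (2)] -/
theorem mk_slab_unit_len_eq (c : ℚ) {a : ℚ} (ha : 0 < a) :
    QuotientAddGroup.mk' relations (of (R a (a + 1) c)) =
      QuotientAddGroup.mk' relations (of (R 1 ((a.num.toNat + a.den : ℕ):ℚ) c)) -
        QuotientAddGroup.mk' relations (of (R 1 (a.num.toNat:ℚ) c)) := by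
  have hnum : 0 < a.num := Rat.num_pos.mpr ha
  have hAZ : ((a.num.toNat : ℕ) : ℤ) = a.num := Int.toNat_of_nonneg hnum.le
  have hD0 : (0:ℚ) < a.den := by exact_mod_cast a.den_pos
  have hA1 : 1 ≤ a.num.toNat := by omega
  have eA : (a.den:ℚ) * a = (a.num.toNat:ℚ) := by
    rw [Rat.den_mul_eq_num]
    exact_mod_cast hAZ.symm
  have eB : (a.den:ℚ) * (a + 1) = ((a.num.toNat + a.den : ℕ):ℚ) := by
    push_cast
    rw [mul_add, eA, mul_one]
  -- scaling by `D`: `[R a (a+1) c] ≡ [R (D a) (D (a+1)) c] = [R A B c]`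
  have h1 : of (R a (a + 1) c) - of (R (a.den * a) (a.den * (a + 1)) c) ∈ relations :=
    dlog_scale_mem_relations (a := a) (b := a + 1) (c := c) (s := a.den) _ _ (hR a _ c ha).1
      (hR (a.den * a) _ c (mul_pos hD0 ha)).1 (fun x _ => by rw [(hR a (a + 1) c ha).2])
      (fun x _ => by rw [(hR (a.den * a) (a.den * (a + 1)) c (mul_pos hD0 ha)).2]) ha hD0
  rw [eA, eB] at h1
  have h2 : QuotientAddGroup.mk' relations (of (R a (a + 1) c)) =
      QuotientAddGroup.mk' relations
        (of (R (a.num.toNat:ℚ) ((a.num.toNat + a.den : ℕ):ℚ) c)) := by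
    rw [QuotientAddGroup.mk'_apply, QuotientAddGroup.mk'_apply, QuotientAddGroup.eq_iff_sub_mem]
    exact h1
  rw [h2, mk_slab_nat_eq hR c hA1 (Nat.le_add_right _ _)]

end Carriers

/-! ## The affine move onto the dlog family -/

section Affine

variable {R : ℚ → ℚ → ℚ → IntegralRep 1}
  (hR : ∀ a b c, 0 < a → (R a b c).domain = {x | x 0 ∈ Set.Ioo (a:ℝ) b} ∧
    (R a b c).integrand = fun x => (c:ℝ) / x 0)
include hR

/-- **Pole to the left** (`ρ < 0`): the affine move `y = x − ρ` (rule 2) gives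
`[(0,1), c/(x−ρ)] = [(−ρ, −ρ+1), c/y]`. [cite: KontsevichZagier2001, §1.2 rule (2)] -/
theorem mk_pole_eq_of_neg {c ρ : ℚ} (hρ : ρ < 0) (T : IntegralRep 1)
    (hTd : T.domain = {x | x 0 ∈ Set.Ioo (0:ℝ) 1})
    (hTi : EqOn T.integrand (fun x => (c:ℝ) / (x 0 - ρ)) T.domain) :
    QuotientAddGroup.mk' relations (of T) =
      QuotientAddGroup.mk' relations (of (R (-ρ) (-ρ + 1) c)) := by
  have ha : (0:ℚ) < -ρ := neg_pos.mpr hρ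
  obtain ⟨hLd, hLi⟩ := hR (-ρ) (-ρ + 1) c ha
  rw [QuotientAddGroup.mk'_apply, QuotientAddGroup.mk'_apply, QuotientAddGroup.eq_iff_sub_mem]
  refine affine_sub_mem_relations (s := 1) (t := -ρ) one_ne_zero T (R (-ρ) (-ρ + 1) c)
    (fun y => (c:ℝ) / y) ?_ ?_ ?_
  · have e1 : ((1:ℚ):ℝ) * 0 + ((-ρ:ℚ):ℝ) = ((-ρ:ℚ):ℝ) := by push_cast; ring
    have e2 : ((1:ℚ):ℝ) * 1 + ((-ρ:ℚ):ℝ) = ((-ρ + 1:ℚ):ℝ) := by push_cast; ring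
    rw [hLd, hTd, image_affine_slab_of_pos (by exact_mod_cast (one_pos : (0:ℚ) < 1)), e1, e2]
  · intro x _
    rw [hLi]
  · intro x hx
    rw [hTi hx]
    show (c:ℝ) / (x 0 - ρ) = (c:ℝ) / (((1:ℚ):ℝ) * x 0 + ((-ρ:ℚ):ℝ)) * |((1:ℚ):ℝ)|
    push_cast
    rw [abs_one, mul_one, one_mul, sub_eq_add_neg]

/-- **Pole to the right** (`1 < ρ`): the affine move `y = ρ − x` (rule 2, orientation-reversing,
Jacobian `|−1| = 1`) gives `[(0,1), c/(x−ρ)] = [(ρ−1, ρ), (−c)/y]`.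
[cite: KontsevichZagier2001, §1.2 rule (2)] -/
theorem mk_pole_eq_of_one_lt {c ρ : ℚ} (hρ : 1 < ρ) (T : IntegralRep 1)
    (hTd : T.domain = {x | x 0 ∈ Set.Ioo (0:ℝ) 1})
    (hTi : EqOn T.integrand (fun x => (c:ℝ) / (x 0 - ρ)) T.domain) :
    QuotientAddGroup.mk' relations (of T) =
      QuotientAddGroup.mk' relations (of (R (ρ - 1) (ρ - 1 + 1) (-c))) := by
  have ha : (0:ℚ) < ρ - 1 := sub_pos.mpr hρ
  obtain ⟨hLd, hLi⟩ := hR (ρ - 1) (ρ - 1 + 1) (-c) ha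
  rw [QuotientAddGroup.mk'_apply, QuotientAddGroup.mk'_apply, QuotientAddGroup.eq_iff_sub_mem]
  refine affine_sub_mem_relations (s := -1) (t := ρ) (by norm_num) T (R (ρ - 1) (ρ - 1 + 1) (-c))
    (fun y => ((-c:ℚ):ℝ) / y) ?_ ?_ ?_
  · have e1 : ((-1:ℚ):ℝ) * 1 + ((ρ:ℚ):ℝ) = ((ρ - 1:ℚ):ℝ) := by push_cast; ring
    have e2 : ((-1:ℚ):ℝ) * 0 + ((ρ:ℚ):ℝ) = ((ρ - 1 + 1:ℚ):ℝ) := by push_cast; ring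
    rw [hLd, hTd, image_affine_slab_of_neg (by exact_mod_cast (by norm_num : (-1:ℚ) < 0)), e1, e2]
  · intro x _
    rw [hLi]
  · intro x hx
    rw [hTi hx]
    show (c:ℝ) / (x 0 - ρ) = ((-c:ℚ):ℝ) / (((-1:ℚ):ℝ) * x 0 + ((ρ:ℚ):ℝ)) * |((-1:ℚ):ℝ)|
    have e : ((-1:ℚ):ℝ) * x 0 + ((ρ:ℚ):ℝ) = -(x 0 - ρ) := by push_cast; ring
    rw [e, Rat.cast_neg c, neg_div_neg_eq, Rat.cast_neg, Rat.cast_one, abs_neg, abs_one, mul_one]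

end Affine

/-! ## The registered sub-goal `nf_pole_one` -/

/-- **A simple rational pole is in normal form** (registered sub-goal `nf_pole_one` of crux
stmt-KontsevichZagierPeriods-3869, line `SketchIdeator1`, split-denominator layer of the leaf
`stub_boxRigidity`). With the dlog family `R a b c = [(a,b), c/y]` (`0 < a`) and the point family
`Z r = [pt, r]`: for `ρ ∈ ℚ ∖ [0,1]` and `T = [(0,1), c/(x − ρ)]` there are `r ∈ ℚ`, a finite set
`S` of primes and coefficients `C : ℕ → ℚ` supported on `S` with
`[T] = [Z r] + Σ_{p ∈ S} [R 1 p (C p)]` in `FormalRep ⧸ relations`. In fact `r = 0`,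
`S = primeFactors A ∪ primeFactors B` and `C p = (v_p(B) − v_p(A))·c'`, where after the affine
move `[T] = [R a (a+1) c']` one has `A = num a`, `B = A + den a` (value check:
`∫₀¹ c dx/(x−ρ) = c' log((a+1)/a) = Σ_p (v_p(B) − v_p(A)) c' log p`). Assembled from the landed
moves of `…DlogMoves` and `…SplitMoves` only. [cite: KontsevichZagier2001, §1.2 rules (1), (2)] -/
theorem nf_pole_one {R : ℚ → ℚ → ℚ → IntegralRep 1} {Z : ℚ → IntegralRep 0}
    (hR : ∀ a b c, 0 < a → (R a b c).domain = {x | x 0 ∈ Set.Ioo (a:ℝ) b} ∧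
      (R a b c).integrand = fun x => (c:ℝ) / x 0)
    (hZ : ∀ r, (Z r).domain = univ ∧ (Z r).integrand = fun _ => (r:ℝ)) {c ρ : ℚ}
    (hρ : (ρ:ℝ) ∉ Set.Icc (0:ℝ) 1) (T : IntegralRep 1)
    (hTd : T.domain = {x | x 0 ∈ Set.Ioo (0:ℝ) 1})
    (hTi : EqOn T.integrand (fun x => (c:ℝ) / (x 0 - ρ)) T.domain) :
    ∃ (r : ℚ) (S : Finset ℕ) (C : ℕ → ℚ), (∀ p ∈ S, p.Prime) ∧ (∀ p, p ∉ S → C p = 0) ∧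
      QuotientAddGroup.mk' relations (of T) = QuotientAddGroup.mk' relations (of (Z r)) +
        ∑ p ∈ S, QuotientAddGroup.mk' relations (of (R 1 p (C p))) := by
  -- Step 1: the affine move onto a dlog slab of length one, `[T] = [R a (a+1) c']`, `0 < a`.
  obtain ⟨a, c', ha, hT⟩ : ∃ a c' : ℚ, 0 < a ∧ QuotientAddGroup.mk' relations (of T) =
      QuotientAddGroup.mk' relations (of (R a (a + 1) c')) := by
    simp only [Set.mem_Icc, not_and_or, not_le] at hρ
    rcases hρ with hρ | hρ
    · exact ⟨-ρ, c, neg_pos.mpr (by exact_mod_cast hρ),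
        mk_pole_eq_of_neg hR (by exact_mod_cast hρ) T hTd hTi⟩
    · exact ⟨ρ - 1, -c, sub_pos.mpr (by exact_mod_cast hρ),
        mk_pole_eq_of_one_lt hR (by exact_mod_cast hρ) T hTd hTi⟩
  -- Step 2: integer ends `A = num a`, `B = A + den a` (both nonzero).
  have hnum : 0 < a.num := Rat.num_pos.mpr ha
  have hA0 : a.num.toNat ≠ 0 := by omega
  have hB0 : a.num.toNat + a.den ≠ 0 := by
    have := a.den_pos
    omega
  -- Step 3: prime decomposition of both carriers over `S = primeFactors A ∪ primeFactors B`.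
  refine ⟨0, (a.num.toNat).primeFactors ∪ (a.num.toNat + a.den).primeFactors, fun p =>
    (((a.num.toNat + a.den).factorization p : ℚ) - ((a.num.toNat).factorization p : ℚ)) * c',
    ?_, ?_, ?_⟩
  · intro p hp
    rcases Finset.mem_union.mp hp with hp | hp <;> exact Nat.prime_of_mem_primeFactors hp
  · intro p hp
    rw [Finset.mem_union, not_or] at hp
    have h1 : (a.num.toNat).factorization p = 0 := by
      rw [← Finsupp.notMem_support_iff, Nat.support_factorization]
      exact hp.1
    have h2 : (a.num.toNat + a.den).factorization p = 0 := by
      rw [← Finsupp.notMem_support_iff, Nat.support_factorization]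
      exact hp.2
    simp only [h1, h2, Nat.cast_zero, sub_zero, zero_mul]
  · -- `[Z 0] = 0`, then `[T] = Λ(B, c') − Λ(A, c') = Σ_{p ∈ S} [R 1 p ((v_p B − v_p A) c')]`
    have hZ0 : QuotientAddGroup.mk' relations (of (Z 0)) = 0 := by
      rw [QuotientAddGroup.mk'_apply, QuotientAddGroup.eq_zero_iff]
      exact pt_zero_mem_relations (Z 0) (by rw [(hZ 0).2, Rat.cast_zero])
    rw [hZ0, zero_add, hT, mk_slab_unit_len_eq hR c' ha,
      mk_carrier_eq_finset_sum hR c' hB0 Finset.subset_union_right,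
      mk_carrier_eq_finset_sum hR c' hA0 Finset.subset_union_left, ← Finset.sum_sub_distrib]
    refine Finset.sum_congr rfl fun p _ => ?_
    rw [mk_dlog_sub hR one_pos]
    simp only [sub_mul]

end SiegeK3

end Dlog

end Summit.KontsevichZagierPeriods.HurwitzMicroSectors.NormalFormPrinciple.PiBox
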